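import Mathlib
import HarnessLib
import Literature.MathematicalPhysics.QuantumLattice.TorusBandParticleHole
import Literature.MathematicalPhysics.QuantumLattice.HubbardFreeCovariance
import Literature.MathematicalPhysics.QuantumLattice.DWaveGapLatticeCount
import Summits.HubbardSuperconductivity.HubbardSuperconductivity.Theorems.KLProgrammeUVTadpolePairingLowerBound

/-!
# Route `KLProgramme` — ENGINE item stmt-HubbardSuperconductivity-20437, row (C) credit path, GAP G-005 «TADPOLE-NONVANISHING»:
# THE TWO INSTANTIATION LEMMAS OF THE PAIRING BOUND — the half-zone shift as the antipode for EVERY `L` (slack `4π/L`), and Salmhofer's cutoff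
# as an admissible weight (cell gate-hubbard-kl, registrant seat gate-hubbard-kl-p1b g18; D-0071 pre-staging, route v3)

* `abs_torusBand_add_halfShift_add_le` — for EVERY `L ≥ 1` and `Q = (⌊L/2⌋, ⌊L/2⌋)`: `|ε_L(k + Q) + ε_L(k)| ≤ 4π/L` (exactly `0` for even `L`,
  `torusBand_add_halfShift`); so `σ := Equiv.addRight Q`, `δ := 4π/L` feed `sum_uvTadpole_ge` (p717470) for every parity;
* `salmhoferWeight_nonneg/le_one/eq_one` — the weight `w(i,k) = χ₂((ωᵢ² + e_k²)/Λ₀²)` (`salmhoferCutoff`) is in `[0,1]` and equals `1` as soon as `|e_k| ≥ Λ₀ > 0`;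
* `sum_uvTadpole_salmhofer_halfShift_ge` — `sum_uvTadpole_ge` with these two choices substituted: the explicit lower bound for the UV Hartree sum with
  Salmhofer's weight, any `L`, in terms of the van Hove shell count at width `−μ − Λ₀ − 4π/L` (count it from below with `card_vanHoveShell_ge_of_le`, p717073).
Elementary; nothing here asserts G-005 (the reduction of the scale-0 flow piece to this sum is the scale-0 lane's), any row of 20437, K3, the Kohn–Luttinger margin or
superconductivity.  0 kit · 0 lit.  References: BGM 2006 §2.1–2.3 [cite: BenfattoGiulianiMastropietro2006]; Salmhofer 1999 §4.2.5 (4.71) (the cutoff) [folklore].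
-/

noncomputable section

namespace Summit.HubbardSuperconductivity.HubbardSuperconductivity.Theorems.MatsubaraTadpole

set_option linter.dupNamespace false -- summit = problem name (single-conjunct summit), D-0017

open Real Finset Literature.MathematicalPhysics.QuantumLattice Literature.Probability.LatticeModels

/-! ## §1 The half-zone shift is an antipode up to `4π/L`, for every `L` -/

variable {L : ℕ} [NeZero L]

/-- One coordinate: `|cos(2π(k + ⌊L/2⌋)/L) + cos(2πk/L)| ≤ π/L` (`2⌊L/2⌋ = L − (L mod 2)`, `cos(a + π − ρ) = −cos(a − ρ)`, `|cos x − cos y| ≤ |x − y|`). -/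
theorem abs_cos_add_halfShift_add_cos_le (k : ZMod L) :
    |Real.cos (2 * π * (((k + ((L / 2 : ℕ) : ZMod L)).val : ℝ)) / L) + Real.cos (2 * π * ((k.val : ℝ)) / L)| ≤ π / L := by
  have hL0 : 0 < L := Nat.pos_of_ne_zero (NeZero.ne L)
  have hLr : (0 : ℝ) < L := by exact_mod_cast hL0
  have hval : ((L / 2 : ℕ) : ZMod L).val = L / 2 := ZMod.val_cast_of_lt (Nat.div_lt_self hL0 one_lt_two)
  rw [ZMod.val_add, hval, cos_two_pi_mul_mod_div _ _ hLr, Nat.cast_add]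
  -- `2π(k + ⌊L/2⌋)/L = 2πk/L + π − π r/L` with `r = L mod 2`
  set r : ℕ := L % 2 with hr
  have h2 : (2 * (L / 2 : ℕ) : ℝ) = (L : ℝ) - r := by
    have : 2 * (L / 2) + L % 2 = L := Nat.div_add_mod L 2
    have : ((2 * (L / 2) + L % 2 : ℕ) : ℝ) = L := by exact_mod_cast this
    push_cast at this
    linarith
  have hang : 2 * π * ((k.val : ℝ) + ((L / 2 : ℕ) : ℝ)) / L = (2 * π * (k.val : ℝ) / L - π * r / L) + π := by
    have : 2 * π * ((L / 2 : ℕ) : ℝ) / L = π - π * r / L := by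
      rw [show 2 * π * ((L / 2 : ℕ) : ℝ) = π * (2 * (L / 2 : ℕ) : ℝ) by ring, h2]
      field_simp
    rw [show 2 * π * ((k.val : ℝ) + ((L / 2 : ℕ) : ℝ)) / L = 2 * π * (k.val : ℝ) / L + 2 * π * ((L / 2 : ℕ) : ℝ) / L by ring, this]
    ring
  rw [hang, Real.cos_add_pi]
  have hlip := Real.abs_cos_sub_cos_le (2 * π * (k.val : ℝ) / L) (2 * π * (k.val : ℝ) / L - π * r / L)
  have hr1 : (r : ℝ) ≤ 1 := by exact_mod_cast Nat.lt_succ_iff.1 (Nat.mod_lt L two_pos)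
  have hr0 : (0 : ℝ) ≤ r := Nat.cast_nonneg _
  calc |-(Real.cos (2 * π * (k.val : ℝ) / L - π * r / L)) + Real.cos (2 * π * (k.val : ℝ) / L)|
      = |Real.cos (2 * π * (k.val : ℝ) / L) - Real.cos (2 * π * (k.val : ℝ) / L - π * r / L)| := by ring_nf
    _ ≤ |2 * π * (k.val : ℝ) / L - (2 * π * (k.val : ℝ) / L - π * r / L)| := hlip
    _ = π * r / L := by rw [show 2 * π * (k.val : ℝ) / L - (2 * π * (k.val : ℝ) / L - π * r / L) = π * r / L by ring]; exact abs_of_nonneg (by positivity)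
    _ ≤ π / L := by
        apply div_le_div_of_nonneg_right _ hLr.le
        nlinarith [Real.pi_pos]

/-- **The half-zone shift is an antipode up to `4π/L`**: for every `L ≥ 1`, `Q = (⌊L/2⌋, ⌊L/2⌋)`, `k ∈ (ℤ/Lℤ)²`: `|ε_L(k + Q) + ε_L(k)| ≤ 4π/L`
(`= 0` for even `L`, `torusBand_add_halfShift`). -/
theorem abs_torusBand_add_halfShift_add_le (k : TorusSite 2 L) :
    |torusBand L (k + (fun _ => ((L / 2 : ℕ) : ZMod L) : TorusSite 2 L)) + torusBand L k| ≤ 4 * π / L := by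
  have h0 := abs_cos_add_halfShift_add_cos_le (L := L) (k 0)
  have h1 := abs_cos_add_halfShift_add_cos_le (L := L) (k 1)
  rw [torusBand_two_eq, torusBand_two_eq]
  simp only [Pi.add_apply]
  have hL0 : (0 : ℝ) < L := by exact_mod_cast Nat.pos_of_ne_zero (NeZero.ne L)
  calc |-2 * Real.cos (2 * π * (((k 0 + ((L / 2 : ℕ) : ZMod L)).val : ℝ)) / L) -
          2 * Real.cos (2 * π * (((k 1 + ((L / 2 : ℕ) : ZMod L)).val : ℝ)) / L) +
        (-2 * Real.cos (2 * π * ((k 0).val : ℝ) / L) - 2 * Real.cos (2 * π * ((k 1).val : ℝ) / L))|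
      = 2 * |(Real.cos (2 * π * (((k 0 + ((L / 2 : ℕ) : ZMod L)).val : ℝ)) / L) + Real.cos (2 * π * ((k 0).val : ℝ) / L)) +
          (Real.cos (2 * π * (((k 1 + ((L / 2 : ℕ) : ZMod L)).val : ℝ)) / L) + Real.cos (2 * π * ((k 1).val : ℝ) / L))| := by
        rw [show -2 * Real.cos (2 * π * (((k 0 + ((L / 2 : ℕ) : ZMod L)).val : ℝ)) / L) -
            2 * Real.cos (2 * π * (((k 1 + ((L / 2 : ℕ) : ZMod L)).val : ℝ)) / L) +
            (-2 * Real.cos (2 * π * ((k 0).val : ℝ) / L) - 2 * Real.cos (2 * π * ((k 1).val : ℝ) / L)) =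
            (-2) * ((Real.cos (2 * π * (((k 0 + ((L / 2 : ℕ) : ZMod L)).val : ℝ)) / L) + Real.cos (2 * π * ((k 0).val : ℝ) / L)) +
              (Real.cos (2 * π * (((k 1 + ((L / 2 : ℕ) : ZMod L)).val : ℝ)) / L) + Real.cos (2 * π * ((k 1).val : ℝ) / L))) by ring,
          abs_mul]
        norm_num
    _ ≤ 2 * (π / L + π / L) := by
        gcongr
        exact (abs_add_le _ _).trans (add_le_add h0 h1)
    _ = 4 * π / L := by ring

/-! ## §2 Salmhofer's cutoff is an admissible weight -/

section Weight

variable {M : ℕ} {β μ Λ₀ : ℝ}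

omit [NeZero L] in
/-- The UV weight `w(i,k) = χ₂((ωᵢ² + e_k²)/Λ₀²)` is nonnegative. -/
theorem salmhoferWeight_nonneg (i : MatsubaraIdx M) (k : TorusSite 2 L) :
    0 ≤ salmhoferCutoff ((matsubaraFreq β M i ^ 2 + (torusBand L k - μ) ^ 2) / Λ₀ ^ 2) :=
  (salmhoferCutoff_mem_Icc _).1

omit [NeZero L] in
/-- … and at most `1`. -/
theorem salmhoferWeight_le_one (i : MatsubaraIdx M) (k : TorusSite 2 L) :
    salmhoferCutoff ((matsubaraFreq β M i ^ 2 + (torusBand L k - μ) ^ 2) / Λ₀ ^ 2) ≤ 1 :=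
  (salmhoferCutoff_mem_Icc _).2

omit [NeZero L] in
/-- **Off the sliver the UV weight is `1`**: `Λ₀ ≤ |e_k|` (`Λ₀ > 0`) ⇒ `(ωᵢ² + e_k²)/Λ₀² ≥ 1` ⇒ `χ₂ = 1`. -/
theorem salmhoferWeight_eq_one (hΛ : 0 < Λ₀) (i : MatsubaraIdx M) (k : TorusSite 2 L) (hk : Λ₀ ≤ |torusBand L k - μ|) :
    salmhoferCutoff ((matsubaraFreq β M i ^ 2 + (torusBand L k - μ) ^ 2) / Λ₀ ^ 2) = 1 := by
  apply salmhoferCutoff_of_ge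
  rw [le_div_iff₀ (by positivity), one_mul]
  have h1 : Λ₀ ^ 2 ≤ (torusBand L k - μ) ^ 2 := by
    rw [← sq_abs (torusBand L k - μ)]
    exact pow_le_pow_left₀ hΛ.le hk 2
  nlinarith [sq_nonneg (matsubaraFreq β M i)]

end Weight

/-! ## §3 The pairing bound with both choices substituted -/

/-- **The UV Hartree sum with Salmhofer's weight, any `L`**: for `β > 0`, `M ≥ 1`, `0 < Λ₀`, `Λ₀ + 4π/L ≤ −μ`:
`½·( #{k : |ε_L(k)| ≤ −μ − Λ₀ − 4π/L}·(1 − 2e^{−βΛ₀}) − L²·(2(4−μ)β/(π²M) + e^{−β(−2μ − Λ₀ − 8π/L)}) )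
 ≤ Σ_k β⁻¹Σᵢ χ₂((ωᵢ²+e_k²)/Λ₀²)·e_k/(ωᵢ² + e_k²)`. -/
theorem sum_uvTadpole_salmhofer_halfShift_ge {M : ℕ} {β μ Λ₀ : ℝ} (hβ : 0 < β) (hM : 1 ≤ M) (hΛ : 0 < Λ₀)
    (hμ : Λ₀ + 4 * π / L ≤ -μ) :
    (((univ.filter fun k : TorusSite 2 L => |torusBand L k| ≤ -μ - Λ₀ - 4 * π / L).card : ℝ) * (1 - 2 * Real.exp (-(β * Λ₀))) -
        (L : ℝ) ^ 2 * (2 * ((4 - μ) * β / (π ^ 2 * M)) + Real.exp (-(β * (-2 * μ - Λ₀ - 2 * (4 * π / L)))))) / 2 ≤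
      ∑ k : TorusSite 2 L, β⁻¹ * ∑ i : MatsubaraIdx M,
        salmhoferCutoff ((matsubaraFreq β M i ^ 2 + (torusBand L k - μ) ^ 2) / Λ₀ ^ 2) *
          ((torusBand L k - μ) / (matsubaraFreq β M i ^ 2 + (torusBand L k - μ) ^ 2)) := by
  have hδ : (0 : ℝ) ≤ 4 * π / L := by positivity
  exact sum_uvTadpole_ge hβ hM hΛ hδ hμ
    (fun i k => salmhoferCutoff ((matsubaraFreq β M i ^ 2 + (torusBand L k - μ) ^ 2) / Λ₀ ^ 2))
    (fun i k => salmhoferWeight_nonneg i k) (fun i k => salmhoferWeight_le_one i k) (fun i k hk => salmhoferWeight_eq_one hΛ i k hk)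
    (Equiv.addRight (fun _ => ((L / 2 : ℕ) : ZMod L) : TorusSite 2 L)) (fun k => abs_torusBand_add_halfShift_add_le k)

end Summit.HubbardSuperconductivity.HubbardSuperconductivity.Theorems.MatsubaraTadpole

end
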